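import Summits.CriticalPhenomena.PercolationContinuityZ3.Theorems.PercNearOneGluingNoHeavyLowerTailCSHPsiUnfoldDecoy
import Summits.CriticalPhenomena.PercolationContinuityZ3.Theorems.PercNearOneGluingNoHeavyLowerTailCSHUnfold
import HarnessLib

/-!
# Pinned hierarchy (PIN-CSH), Lemma U_ψ for general `k`: the decoy terms of the PINNED ROW summed along the decoy list

Definitions file (`--supports stmt-CriticalPhenomena-4575`), route task `nh-dp-fatminority` (line fat-minority-linear, gen 16); memo
`run/shared/lean/prim/prim-nh-dp-fatminority/CSH-PSI-MEMO.md` §2 (Lemma U_ψ).  Sixth brick of the Lean proof of memo THEOREM 1_ψ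
(`PinCSH.Holds`).  No named facts, no sorries.  The pinned twin of the `Σ_j` part of prim-ineq-prove-1's `…CSHUnfold.lean`:

* `PinCSH.pCovD_phiT_eq`, `PinCSH.pAvoidConst_eq_div` — dictionary: the pinned covariance row `PinCSH.pCovD` of the sub-system with owner `d` at
  the Lemma-Φ functional `CSH.phiT … d`, and the pinned decoy constant `PinCSH.pAvoidConst`, as sum-level masses/moments of the rows' TEST EVENTS
  (`{d ↔ w'}` at a vertex `w' ≠ o`, `pinEv o 𝓗 d` at the label);
* `PinCSH.psubT` — the accumulated lower-level terms of the pinned unfolding at the LABEL row `o`: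
  `psubT_S([]) = 0`, `psubT_S(d :: ds) = μ(d ↮ S∪Y)⁻¹ · sl_{pL_{>d}}[pCovD_{d,S∪Y}(Φ̃_d)](o) + psubT_{S∪{d}}(ds)` (`pL` the pinned decoy list);
* `PinCSH.sum_wcov_unfoldT_pin` — **the `Σ_j` of Lemma U_ψ at the label**: the `{x↮Y}`-average of the world covariance of `g(C_x)` with the
  pinned unfolded terms `CSH.unfoldT (prel …)` (read in the world, `…CSHPsiLevelForms.lean`) is MINUS `psubT` (the one-decoy world term
  `PinCSH.decoy_world_term_pin` summed along the list).  The rows of genuine vertices (`u ≠ o`) are served by the pure `CSH.sum_wcov_unfoldT`.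
[cite: VandenbergHaggstromKahn2005, §2.1 Lemma 2.4 (p. 10) — corollary] [cite: KozmaNitzan2024, Question 7 (p. 36)]
-/

noncomputable section

namespace Summit.CriticalPhenomena.PercolationContinuityZ3.Theorems

open MeasureTheory Set Literature.Probability.LatticeModels Literature.Probability.Percolation
open scoped Classical
open BHK2006 DecisionTree HullPort CSH

namespace PinCSH

variable {V : Type*} [Fintype V]

/-! ### Dictionary: the pinned row and constant of a sub-system at sum level -/

omit [Fintype V] in
/-- Off the label the pinned covariance row is the pure one. [folklore] -/
theorem pCovD_of_ne (w : Sym2 V → unitInterval) (o : V) (𝓗 : Set (Set (Sym2 V))) (x : V) (Y : Set V) (f : Set (Sym2 V) → ℝ)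
    {u : V} (hu : u ≠ o) : pCovD w o 𝓗 x Y f u = covD w x Y f u := by
  simp [pCovD, hu]

/-- **The pinned covariance row of the sub-system is the centred decoy moment of the row's test event**: for `E = {d ↮ A}` and
`T(w') = {d ↔ w'}` (`w' ≠ o`) / `pinEv o 𝓗 d` (`w' = o`), `pCovD_{d,A}(Φ̃_d)(w') = m₀·P₁(T w') − m₁(T w')·P₀`. [folklore] -/
theorem pCovD_phiT_eq (w : Sym2 V → unitInterval) (o : V) (𝓗 : Set (Set (Sym2 V))) (x : V) (Y A : Set V) (g : Set (Sym2 V) → ℝ)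
    (d w' : V) :
    pCovD w o 𝓗 d A (phiT w x Y g d) w' =
      (∑ ζ, weight (fun e => (w e : ℝ)) ζ * ind (avoidEv d A) ζ) *
          (∑ ζ, weight (fun e => (w e : ℝ)) ζ * (ind (avoidEv d A ∩
            (if w' = o then pinEv o 𝓗 d else (openConn d w' : Set (BondConfig V)))) ζ * phiS (fun e => (w e : ℝ)) x Y g d ζ)) -
        (∑ ζ, weight (fun e => (w e : ℝ)) ζ * ind (avoidEv d A ∩
            (if w' = o then pinEv o 𝓗 d else (openConn d w' : Set (BondConfig V)))) ζ) *
          (∑ ζ, weight (fun e => (w e : ℝ)) ζ * (ind (avoidEv d A) ζ * phiS (fun e => (w e : ℝ)) x Y g d ζ)) := by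
  rw [pCovD_eq_event, TwoAvoidanceSets.real_eq_sum_ind, TwoAvoidanceSets.real_eq_sum_ind, setIntegral_eq_sum_ind,
    setIntegral_eq_sum_ind]
  simp only [phiT_openEdgeCluster]
  have hE : ({ω : BondConfig V | ∀ y ∈ A, ¬ (openGraph ω).Reachable d y} : Set (Set (Sym2 V))) = avoidEv d A := rfl
  rw [hE]
  ring

/-- **The pinned decoy constant is the ratio of masses of the row's test event** (sum level). [folklore] -/
theorem pAvoidConst_eq_div (w : Sym2 V → unitInterval) (o : V) (𝓗 : Set (Set (Sym2 V))) (d : V) (A : Set V) (w' : V) :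
    pAvoidConst w o 𝓗 d A w' = (∑ ζ, weight (fun e => (w e : ℝ)) ζ *
        ind (avoidEv d A ∩ (if w' = o then pinEv o 𝓗 d else (openConn d w' : Set (BondConfig V)))) ζ) /
      ∑ ζ, weight (fun e => (w e : ℝ)) ζ * ind (avoidEv d A) ζ := by
  by_cases hw' : w' = o
  · subst hw'
    unfold pAvoidConst
    rw [if_pos rfl, if_pos rfl, TwoAvoidanceSets.real_eq_sum_ind, TwoAvoidanceSets.real_eq_sum_ind]
    rfl
  · rw [pAvoidConst_of_ne w o 𝓗 d A hw', if_neg hw', avoidConst_eq_div]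

/-! ### The accumulated lower-level terms at the label row -/

/-- The accumulated lower-level terms of the pinned unfolding at the LABEL row, as a recursion along the decoy list with a growing source set
`S` (owner + earlier decoys): `psubT_S([]) = 0`, `psubT_S(d :: ds) = μ(d ↮ S∪Y)⁻¹ · sl_{pL_{>d}}[pCovD_{d,S∪Y}(Φ̃_d)](o) + psubT_{S∪{d}}(ds)`.
(transcription of the memo prim-nh-dp-fatminority CSH-PSI-MEMO.md §2 Lemma U_ψ, the sum over `j`, ψ-row) [folklore] -/
def psubT (w : Sym2 V → unitInterval) (o : V) (𝓗 : Set (Set (Sym2 V))) (x : V) (Y : Set V) (g : Set (Sym2 V) → ℝ) :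
    Set V → List V → ℝ
  | _, [] => 0
  | S, d :: ds => ((prodBernoulli w).real (avoidEv d (S ∪ Y)))⁻¹ *
        slForm (pDecoyList w o 𝓗 (insert d (S ∪ Y)) ds) (pCovD w o 𝓗 d (S ∪ Y) (phiT w x Y g d)) o +
      psubT w o 𝓗 x Y g (insert d S) ds

omit [Fintype V] in
/-- Unfolding of `psubT` at the empty list. [folklore] -/
@[simp] theorem psubT_nil (w : Sym2 V → unitInterval) (o : V) (𝓗 : Set (Set (Sym2 V))) (x : V) (Y : Set V)
    (g : Set (Sym2 V) → ℝ) (S : Set V) : psubT w o 𝓗 x Y g S [] = 0 := rfl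

omit [Fintype V] in
/-- Unfolding of `psubT` at a cons. [folklore] -/
theorem psubT_cons (w : Sym2 V → unitInterval) (o : V) (𝓗 : Set (Set (Sym2 V))) (x : V) (Y : Set V)
    (g : Set (Sym2 V) → ℝ) (S : Set V) (d : V) (ds : List V) :
    psubT w o 𝓗 x Y g S (d :: ds) = ((prodBernoulli w).real (avoidEv d (S ∪ Y)))⁻¹ *
        slForm (pDecoyList w o 𝓗 (insert d (S ∪ Y)) ds) (pCovD w o 𝓗 d (S ∪ Y) (phiT w x Y g d)) o +
      psubT w o 𝓗 x Y g (insert d S) ds := rfl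

/-! ### Summing the pinned decoy terms along the list -/

/-- **The `Σ_j` of Lemma U_ψ at the label**: the `{x↮Y}`-average of the world covariance of `g(C_x)` with the pinned unfolded terms
`unfoldT (prel …)` (read in the world: open reachability and the pinned predicate `u ↦ u ↔ o ∧ C_u ∈ 𝓗` of the world configuration) is MINUS
the accumulated lower-level terms `psubT`.  Hypotheses: non-degenerate weights, `x ∈ S`, the decoys distinct, outside `S ∪ Y` and different from
the label `o`. (transcription of the memo prim-nh-dp-fatminority CSH-PSI-MEMO.md §2 Lemma U_ψ, sum over the decoys, ψ-row)
[cite: VandenbergHaggstromKahn2005, §2.1 Lemma 2.4 (p. 10) — corollary] -/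
theorem sum_wcov_unfoldT_pin (w : Sym2 V → unitInterval) (hw : ∀ e, 0 < w e ∧ w e < 1) (o : V) (𝓗 : Set (Set (Sym2 V))) (x : V)
    (Y : Set V) (g : Set (Sym2 V) → ℝ) :
    ∀ (D : List V) (S : Set V), x ∈ S → D.Nodup → (∀ d ∈ D, d ∉ S ∧ d ∉ Y ∧ d ≠ o) →
      ∑ ω, weight (fun e => (w e : ℝ)) ω * (ind (avoidEv x Y) ω *
          wcovOff (fun e => (w e : ℝ)) Y (fun β => g (openEdgeCluster β x))
            (fun ζ => unfoldT (prel (openGraph ζ).Reachable (fun u => (openGraph ζ).Reachable u o ∧ openEdgeCluster ζ u ∈ 𝓗) o)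
              S (pDecoyList w o 𝓗 (S ∪ Y) D) o) ω) =
        - psubT w o 𝓗 x Y g S D := by
  intro D
  induction D with
  | nil =>
    intro S _ _ _
    simp only [pDecoyList, unfoldT, psubT, neg_zero]
    exact Finset.sum_eq_zero fun ω _ => by rw [wcovOff_zero_right]; ring
  | cons d ds ih =>
    intro S hxS hnd hdis
    set ŵ : Sym2 V → ℝ := fun e => (w e : ℝ) with hŵ
    have hm : ∑ ω, weight ŵ ω = 1 := by
      have h1 := integral_prodBernoulli_eq_sum w fun _ => (1 : ℝ)
      simp only [integral_const, probReal_univ, smul_eq_mul, mul_one] at h1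
      exact h1.symm
    have hdS : d ∉ S := (hdis d List.mem_cons_self).1
    have hdY : d ∉ Y := (hdis d List.mem_cons_self).2.1
    have hdo : d ≠ o := (hdis d List.mem_cons_self).2.2
    have hnd' : ds.Nodup := (List.nodup_cons.1 hnd).2
    have hd_notin : d ∉ ds := (List.nodup_cons.1 hnd).1
    -- the list unfolds at the head
    have hL : pDecoyList w o 𝓗 (S ∪ Y) (d :: ds) =
        (d, pAvoidConst w o 𝓗 d (S ∪ Y)) :: pDecoyList w o 𝓗 (insert d (S ∪ Y)) ds := rfl
    have hset : insert d (S ∪ Y) = insert d S ∪ Y := by rw [Set.insert_union]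
    have hL' : ∀ dc ∈ pDecoyList w o 𝓗 (insert d (S ∪ Y)) ds, dc.1 ≠ d := by
      intro dc hdc hEq
      have : dc.1 ∈ (pDecoyList w o 𝓗 (insert d (S ∪ Y)) ds).map Prod.fst := List.mem_map.2 ⟨dc, hdc, rfl⟩
      rw [map_fst_pDecoyList, hEq] at this
      exact hd_notin this
    have hm₀ : ∑ ζ, weight ŵ ζ * ind (avoidEv d (S ∪ Y)) ζ ≠ 0 :=
      sum_ind_avoidEv_ne_zero w hw (fun h => h.elim hdS hdY)
    -- split the test function
    have hsplit : ∀ ω, wcovOff ŵ Y (fun β => g (openEdgeCluster β x))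
        (fun ζ => unfoldT (prel (openGraph ζ).Reachable (fun u => (openGraph ζ).Reachable u o ∧ openEdgeCluster ζ u ∈ 𝓗) o)
          S (pDecoyList w o 𝓗 (S ∪ Y) (d :: ds)) o) ω =
        wcovOff ŵ Y (fun β => g (openEdgeCluster β x))
          (fun ζ => av (prel (openGraph ζ).Reachable (fun u => (openGraph ζ).Reachable u o ∧ openEdgeCluster ζ u ∈ 𝓗) o) S d *
            slForm (pDecoyList w o 𝓗 (insert d (S ∪ Y)) ds) (fun w' => chi (prel (openGraph ζ).Reachable
              (fun u => (openGraph ζ).Reachable u o ∧ openEdgeCluster ζ u ∈ 𝓗) o) w' d - pAvoidConst w o 𝓗 d (S ∪ Y) w') o) ω +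
        wcovOff ŵ Y (fun β => g (openEdgeCluster β x))
          (fun ζ => unfoldT (prel (openGraph ζ).Reachable (fun u => (openGraph ζ).Reachable u o ∧ openEdgeCluster ζ u ∈ 𝓗) o)
            (insert d S) (pDecoyList w o 𝓗 (insert d S ∪ Y) ds) o) ω := by
      intro ω
      rw [← wcovOff_add_right, hL]
      simp only [unfoldT, hset]
    -- the head term: `decoy_world_term_pin`, rewritten with `pCovD_{d}(Φ̃_d)`
    have hhead := decoy_world_term_pin ŵ hm x Y g hxS hdS o 𝓗 hdo (pDecoyList w o 𝓗 (insert d (S ∪ Y)) ds) hL'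
      (pAvoidConst w o 𝓗 d (S ∪ Y)) hm₀ (fun w' => pAvoidConst_eq_div w o 𝓗 d (S ∪ Y) w')
    have hQ : (fun w' =>
        (∑ ζ, weight ŵ ζ * ind (avoidEv d (S ∪ Y)) ζ) *
            (∑ ζ, weight ŵ ζ * (ind (avoidEv d (S ∪ Y) ∩
              (if w' = o then pinEv o 𝓗 d else (openConn d w' : Set (BondConfig V)))) ζ * phiS ŵ x Y g d ζ)) -
          (∑ ζ, weight ŵ ζ * ind (avoidEv d (S ∪ Y) ∩
              (if w' = o then pinEv o 𝓗 d else (openConn d w' : Set (BondConfig V)))) ζ) *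
            (∑ ζ, weight ŵ ζ * (ind (avoidEv d (S ∪ Y)) ζ * phiS ŵ x Y g d ζ))) =
        pCovD w o 𝓗 d (S ∪ Y) (phiT w x Y g d) := by
      funext w'; rw [pCovD_phiT_eq]
    rw [hQ, ← TwoAvoidanceSets.real_eq_sum_ind] at hhead
    -- assemble with the induction hypothesis at the source set `S ∪ {d}`
    have htail := ih (insert d S) (Set.mem_insert_of_mem d hxS) hnd' (fun e he =>
      ⟨fun h' => (Set.mem_insert_iff.1 h').elim (fun h0 => hd_notin (h0 ▸ he)) (hdis e (List.mem_cons_of_mem d he)).1,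
        (hdis e (List.mem_cons_of_mem d he)).2.1, (hdis e (List.mem_cons_of_mem d he)).2.2⟩)
    have e : ∀ ω, weight ŵ ω * (ind (avoidEv x Y) ω * wcovOff ŵ Y (fun β => g (openEdgeCluster β x))
        (fun ζ => unfoldT (prel (openGraph ζ).Reachable (fun u => (openGraph ζ).Reachable u o ∧ openEdgeCluster ζ u ∈ 𝓗) o)
          S (pDecoyList w o 𝓗 (S ∪ Y) (d :: ds)) o) ω) =
        weight ŵ ω * (ind (avoidEv x Y) ω * wcovOff ŵ Y (fun β => g (openEdgeCluster β x))
          (fun ζ => av (prel (openGraph ζ).Reachable (fun u => (openGraph ζ).Reachable u o ∧ openEdgeCluster ζ u ∈ 𝓗) o) S d *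
            slForm (pDecoyList w o 𝓗 (insert d (S ∪ Y)) ds) (fun w' => chi (prel (openGraph ζ).Reachable
              (fun u => (openGraph ζ).Reachable u o ∧ openEdgeCluster ζ u ∈ 𝓗) o) w' d - pAvoidConst w o 𝓗 d (S ∪ Y) w') o) ω) +
        weight ŵ ω * (ind (avoidEv x Y) ω * wcovOff ŵ Y (fun β => g (openEdgeCluster β x))
          (fun ζ => unfoldT (prel (openGraph ζ).Reachable (fun u => (openGraph ζ).Reachable u o ∧ openEdgeCluster ζ u ∈ 𝓗) o)
            (insert d S) (pDecoyList w o 𝓗 (insert d S ∪ Y) ds) o) ω) := by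
      intro ω; rw [hsplit]; ring
    rw [Finset.sum_congr rfl (fun ω _ => e ω), Finset.sum_add_distrib, hhead, htail]
    simp only [psubT, hset]
    ring

end PinCSH

end Summit.CriticalPhenomena.PercolationContinuityZ3.Theorems

end
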